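import Literature.MathematicalPhysics.QuantumFieldTheory.CentreDominatedWilsonLoops
import Literature.Probability.LatticeModels.GKSFrozenProduct
import HarnessLib

/-!
# The gauge-invariant Ising model (`ℤ₂` lattice gauge theory with `ℤ₂` matter, unitary gauge):
# GKS inequalities and the Marra–Miracle-Solé perimeter law at `β_ℓ > 0`

R. Marra, S. Miracle-Solé, *On the statistical mechanics of the gauge invariant Ising model*, Comm.
Math. Phys. **67** (1979) 233–240 [MarraMiraclesole1979]. The model (their (1)): `ℤ₂` spins
`θ(x)` on sites and `j(x,x')` on links, `H = −β_ℓ ∑ θ(x) j(x,x') θ(x') − β_p ∑_P j(P)`; «As any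
gauge invariant function of the configuration depends only on the reduced variables
`τ(x,x') = θ(x) j(x,x') θ(x')` one can reinterpret the model as having only configuration variables
`τ(x,x')` and hamiltonian `H_Λ(τ) = −β_ℓ ∑_{(x,x') ⊂ Λ} τ(x,x') − β_p ∑_{P ⊂ Λ} τ(P)`» (their (3),
«one of the models introduced by Wegner») — a GENERALISED ISING SYSTEM on the links with one
ferromagnetic coupling `β_p` per plaquette and one `β_ℓ` per link, so that the tree's
Friedli–Velenik GKS machinery (`Literature.Probability.LatticeModels.gksExpect`,
`GKSInequalities.lean`) applies verbatim. The printed correlation-inequality result (p. 235):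

«If `β_ℓ` is strictly positive the behaviour of `⟨τ_Γ⟩` is always ruled by the perimeter `|Γ|`.
This fact can easily be proved by means of the Griffiths–Kelly–Sherman inequalities [10] which show
that `⟨τ_Γ⟩`, at some positive `β_p` and `β_ℓ`, is larger than `⟨τ_Γ⟩` at `β_p = 0` and the same
`β_ℓ`. But at this point one finds `⟨τ_Γ⟩ = (th β_ℓ)^{|Γ|}` showing the perimeter behaviour of
`⟨τ_Γ⟩` whenever `β_ℓ > 0`.»

## Main results (everything PROVED; no named fact)

Abstract part (any finite link set `Λ`, any finite family of «plaquette» supports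
`C : ι → Finset Λ`; `GaugeIsing.expect C β_p β_ℓ` = the Gibbs expectation of the weights
`exp(β_p ∑_i ω_{C_i} + β_ℓ ∑_e ω_e)`):
* `GaugeIsing.expect_spinProduct_nonneg` — GKS I: `0 ≤ ⟨ω_A⟩_{β_p,β_ℓ}` for `β_p, β_ℓ ≥ 0`;
* `GaugeIsing.expect_spinProduct_mono` — GKS II comparison: `⟨ω_A⟩` is non-decreasing in
  `(β_p, β_ℓ)` (`|β_p'| ≤ β_p`, `|β_ℓ'| ≤ β_ℓ`);
* `GaugeIsing.expect_zero_spinProduct` — the free point `β_p = 0`: `⟨ω_A⟩_{0,β_ℓ} = (tanh β_ℓ)^{|A|}`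
  (independent links);
* **`GaugeIsing.tanh_pow_le_expect_spinProduct`** — MMS79 p. 235: `(tanh β_ℓ)^{|A|} ≤ ⟨ω_A⟩_{β_p,β_ℓ}`
  for `β_p, β_ℓ ≥ 0` — the PERIMETER-LAW LOWER BOUND at every `β_ℓ > 0`;
* `GaugeIsing.expect_link_zero_eq` / `GaugeIsing.pureGauge_le_expect` — at `β_ℓ = 0` the model is the
  pure `ℤ₂` gauge theory, and matter only INCREASES the loop expectations:
  `⟨ω_A⟩_{β_p, 0} ≤ ⟨ω_A⟩_{β_p, β_ℓ}`.

Torus part (`Λ` = links of `(ℤ/Lℤ)^d`, `C` = `torusPlaqEdges`, `A` = the boundary links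
`rectOddEdges` of a rectangular Wilson loop, `gaugeIsingTorusExpect`):
* `tanh_pow_le_gaugeIsingTorusExpect_wilsonLoop`: `(tanh β_ℓ)^{|∂(R×T)|} ≤ ⟨τ_{∂(R×T)}⟩_{β_p,β_ℓ,L}`;
* `wilsonExpectation_z2_le_gaugeIsingTorusExpect`: the pure `ℤ₂` torus Wilson loop
  `⟨W_{R×T}⟩_{ℤ₂,β_p,L}` (the tree's `wilsonExpectation z2Rep β_p`) is a lower bound of the
  gauge–Higgs loop at every `β_ℓ ≥ 0`.

HONEST FRAMING: a `ℤ₂` gauge–Higgs correlation inequality (finite volume, periodic b.c.); a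
perimeter-law LOWER bound says the Wilson loop does NOT obey an area law once `β_ℓ > 0` (charged
matter screens) — it is not a statement about a mass gap, and nothing here concerns `SU(N)` or the
Yang–Mills problem.

## References

* R. Marra, S. Miracle-Solé, Comm. Math. Phys. 67 (1979) 233–240, §1 p. 235 (held:
  `paper:doi-10-1007-bf01238846`, p0003). [MarraMiraclesole1979]
* S. Friedli, Y. Velenik, *Statistical Mechanics of Lattice Systems* (CUP 2017), §3.8.1 Thm 3.49,
  Exercise 3.31 (GKS for generalised Ising systems). [FriedliVelenik2017]
* F. Wegner, J. Math. Phys. 12 (1971) 2259 (the model). [Wegner1971]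
-/

noncomputable section

open Finset Literature.Probability.LatticeModels Literature.MathematicalPhysics.QuantumLattice

namespace Literature.MathematicalPhysics.QuantumFieldTheory

namespace GaugeIsing

/-! ### 1. Wegner's model (3) of Marra–Miracle-Solé as a generalised Ising system on the links -/

section Abstract

variable {Λ ι : Type*} [Fintype Λ] [DecidableEq Λ] [Fintype ι] (C : ι → Finset Λ)

/-- The couplings of the gauge-invariant Ising model: `β_p` on every plaquette term (index `inl`),
`β_ℓ` on every link (index `inr`) (Marra–Miracle-Solé (3)). [cite: MarraMiraclesole1979, §1 eq. (3)] -/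
def coupling (βp βl : ℝ) : ι ⊕ Λ → ℝ := Sum.elim (fun _ => βp) (fun _ => βl)

/-- The interaction supports: the plaquette supports `C_i` and the single links `{e}`
(Marra–Miracle-Solé (3)). [cite: MarraMiraclesole1979, §1 eq. (3)] -/
def supp : ι ⊕ Λ → Finset Λ := Sum.elim C (fun e => {e})

/-- The Gibbs expectation `⟨f⟩_{β_p,β_ℓ}` of the gauge-invariant Ising model with hamiltonian
`−β_ℓ ∑_e τ_e − β_p ∑_i τ(C_i)` (Marra–Miracle-Solé (3)), as the tree's `gksExpect`.
[cite: MarraMiraclesole1979, §1 eq. (3)] -/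
def expect (βp βl : ℝ) (f : SpinConfig Λ → ℝ) : ℝ :=
  gksExpect univ (coupling (Λ := Λ) (ι := ι) βp βl) (supp C) f

omit [Fintype Λ] [DecidableEq Λ] [Fintype ι] in
/-- The coupling of a plaquette term is `β_p`. [cite: MarraMiraclesole1979, §1 eq. (3)] -/
@[simp] theorem coupling_inl (βp βl : ℝ) (i : ι) : coupling (Λ := Λ) βp βl (Sum.inl i) = βp := rfl

omit [Fintype Λ] [DecidableEq Λ] [Fintype ι] in
/-- The coupling of a link term is `β_ℓ`. [cite: MarraMiraclesole1979, §1 eq. (3)] -/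
@[simp] theorem coupling_inr (βp βl : ℝ) (e : Λ) : coupling (ι := ι) βp βl (Sum.inr e) = βl := rfl

omit [Fintype Λ] [DecidableEq Λ] [Fintype ι] in
/-- The support of a plaquette term. [cite: MarraMiraclesole1979, §1 eq. (3)] -/
@[simp] theorem supp_inl (i : ι) : supp C (Sum.inl i) = C i := rfl

omit [Fintype Λ] [DecidableEq Λ] [Fintype ι] in
/-- The support of a link term is the link. [cite: MarraMiraclesole1979, §1 eq. (3)] -/
@[simp] theorem supp_inr (e : Λ) : supp (ι := ι) C (Sum.inr e) = {e} := rfl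

/-- **GKS I** for the gauge-invariant Ising model: `0 ≤ ⟨τ_A⟩_{β_p,β_ℓ}` for `β_p, β_ℓ ≥ 0`
(Friedli–Velenik Thm 3.49 (3.54) applied to Wegner's model). [cite: FriedliVelenik2017, Thm. 3.49, eq. (3.54), p. 141] -/
theorem expect_spinProduct_nonneg {βp βl : ℝ} (hp : 0 ≤ βp) (hl : 0 ≤ βl) (A : Finset Λ) :
    0 ≤ expect C βp βl (spinProduct A) :=
  gksExpect_spinProduct_nonneg _ _ _ (fun i _ => by cases i <;> simp [hp, hl]) A

/-- **GKS II (comparison of couplings)** for the gauge-invariant Ising model: `⟨τ_A⟩` is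
non-decreasing in both couplings, `⟨τ_A⟩_{β_p',β_ℓ'} ≤ ⟨τ_A⟩_{β_p,β_ℓ}` whenever `|β_p'| ≤ β_p` and
`|β_ℓ'| ≤ β_ℓ` — «the Griffiths–Kelly–Sherman inequalities … show that `⟨τ_Γ⟩`, at some positive
`β_p` and `β_ℓ`, is larger than `⟨τ_Γ⟩` at `β_p = 0` and the same `β_ℓ`». [cite: MarraMiraclesole1979, §1 p. 235] [cite: FriedliVelenik2017, Exercise 3.31] -/
theorem expect_spinProduct_mono [DecidableEq ι] {βp βp' βl βl' : ℝ} (hp : |βp'| ≤ βp) (hl : |βl'| ≤ βl)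
    (A : Finset Λ) :
    expect C βp' βl' (spinProduct A) ≤ expect C βp βl (spinProduct A) :=
  gksExpect_mono_of_abs_le _ _ (fun i _ => by cases i <;> simp [hp, hl]) A

/-- `tanh k = (e^k − e^{−k}) / (e^k + e^{−k})`. [folklore] -/
private theorem tanh_eq_exp_div (k : ℝ) :
    Real.tanh k = (Real.exp k - Real.exp (-k)) / (Real.exp k + Real.exp (-k)) := by
  have hpos : 0 < Real.exp k + Real.exp (-k) := by positivity
  rw [Real.tanh_eq_sinh_div_cosh, Real.sinh_eq, Real.cosh_eq]
  field_simp

omit [DecidableEq Λ] in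
/-- At `β_p = 0` the Boltzmann weight factorises over the links: `∏_e e^{β_ℓ τ_e}`. [folklore] -/
private theorem gksWeight_zero (βl : ℝ) (ω : SpinConfig Λ) :
    gksWeight univ (coupling (Λ := Λ) (ι := ι) 0 βl) (supp C) ω =
      ∏ e, Real.exp (βl * spinAt e ω) := by
  rw [gksWeight, gksHamiltonian, ← Real.exp_sum]
  congr 1
  rw [Fintype.sum_sum_type]
  simp [spinProduct]

/-- At `β_p = 0` the unnormalised expectation of `τ_A` is a product of one-link sums:
`∏_e (e^{β_ℓ} ∓ e^{−β_ℓ})` with the minus sign exactly on the links of `A`. [folklore] -/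
private theorem gksSum_zero_spinProduct (βl : ℝ) (A : Finset Λ) :
    gksSum univ (coupling (Λ := Λ) (ι := ι) 0 βl) (supp C) (spinProduct A) =
      ∏ e, (if e ∈ A then Real.exp βl - Real.exp (-βl) else Real.exp βl + Real.exp (-βl)) := by
  classical
  set g : Λ → ℤˣ → ℝ := fun e u =>
    (if e ∈ A then ((u : ℤ) : ℝ) else 1) * Real.exp (βl * ((u : ℤ) : ℝ)) with hg
  have hterm : ∀ ω : SpinConfig Λ,
      spinProduct A ω * gksWeight univ (coupling (Λ := Λ) (ι := ι) 0 βl) (supp C) ω =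
        ∏ e, g e (ω e) := by
    intro ω
    rw [gksWeight_zero, spinProduct, ← Fintype.prod_ite_mem A (fun x => spinAt x ω),
      ← Finset.prod_mul_distrib]
    rfl
  rw [gksSum, Finset.sum_congr rfl fun ω _ => hterm ω, ← Fintype.piFinset_univ,
    Finset.sum_prod_piFinset]
  refine Finset.prod_congr rfl fun e _ => ?_
  by_cases he : e ∈ A
  · simp only [hg, he, if_true]
    exact sum_units_mul_exp_mul βl
  · simp only [hg, he, if_false, one_mul]
    exact sum_units_exp_mul βl

/-- **The free point `β_p = 0`: independent links**, `⟨τ_A⟩_{0,β_ℓ} = (tanh β_ℓ)^{|A|}` («at this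
point one finds `⟨τ_Γ⟩ = (th β_ℓ)^{|Γ|}`»). [cite: MarraMiraclesole1979, §1 p. 235] -/
theorem expect_zero_spinProduct (βl : ℝ) (A : Finset Λ) :
    expect C 0 βl (spinProduct A) = Real.tanh βl ^ #A := by
  classical
  have h1 : (fun _ : SpinConfig Λ => (1 : ℝ)) = spinProduct (∅ : Finset Λ) := by
    funext ω; simp [spinProduct]
  rw [expect, gksExpect, h1, gksSum_zero_spinProduct, gksSum_zero_spinProduct,
    ← Finset.prod_div_distrib]
  have hpos : 0 < Real.exp βl + Real.exp (-βl) := by positivity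
  have hterm : ∀ e : Λ, (if e ∈ A then Real.exp βl - Real.exp (-βl) else Real.exp βl + Real.exp (-βl)) /
      (if e ∈ (∅ : Finset Λ) then Real.exp βl - Real.exp (-βl) else Real.exp βl + Real.exp (-βl)) =
        if e ∈ A then Real.tanh βl else 1 := by
    intro e
    simp only [Finset.notMem_empty, if_false]
    split_ifs
    · rw [tanh_eq_exp_div]
    · exact div_self hpos.ne'
  rw [Finset.prod_congr rfl fun e _ => hterm e, Finset.prod_ite_mem, Finset.univ_inter,
    Finset.prod_const]

/-- **MARRA–MIRACLE-SOLÉ PERIMETER LAW (lower bound) for the gauge-invariant Ising model**: for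
`β_p ≥ 0`, `β_ℓ ≥ 0` and every finite link set `A`,
`(tanh β_ℓ)^{|A|} ≤ ⟨τ_A⟩_{β_p, β_ℓ}` —
«If `β_ℓ` is strictly positive the behaviour of `⟨τ_Γ⟩` is always ruled by the perimeter `|Γ|` …
`⟨τ_Γ⟩`, at some positive `β_p` and `β_ℓ`, is larger than `⟨τ_Γ⟩` at `β_p = 0` and the same `β_ℓ`.
But at this point one finds `⟨τ_Γ⟩ = (th β_ℓ)^{|Γ|}`» (GKS II + the free point).
[cite: MarraMiraclesole1979, §1 p. 235] -/
theorem tanh_pow_le_expect_spinProduct [DecidableEq ι] {βp βl : ℝ} (hp : 0 ≤ βp) (hl : 0 ≤ βl) (A : Finset Λ) :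
    Real.tanh βl ^ #A ≤ expect C βp βl (spinProduct A) := by
  rw [← expect_zero_spinProduct C βl A]
  exact expect_spinProduct_mono C (by simpa using hp) (by rw [abs_of_nonneg hl]) A

/-- **At `β_ℓ = 0` the model is the pure `ℤ₂` gauge theory** with one coupling `β_p` per
plaquette: the zero link couplings drop out of the Gibbs state («Model (3) at `β_ℓ = 0` has again a
local `ℤ₂` invariance property» — the pure gauge model). [cite: MarraMiraclesole1979, §1 p. 235] -/
theorem expect_link_zero_eq (βp : ℝ) (f : SpinConfig Λ → ℝ) :
    expect C βp 0 f = gksExpect univ (fun _ : ι => βp) C f := by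
  have hw : ∀ ω : SpinConfig Λ, gksWeight univ (coupling (Λ := Λ) (ι := ι) βp 0) (supp C) ω =
      gksWeight univ (fun _ : ι => βp) C ω := fun ω => by
    rw [gksWeight, gksWeight, gksHamiltonian, gksHamiltonian, Fintype.sum_sum_type]
    simp
  simp only [expect, gksExpect, gksSum, hw]

/-- **Matter only increases the loops**: for `β_p, β_ℓ ≥ 0`,
`⟨τ_A⟩_{pure ℤ₂ gauge, β_p} = ⟨τ_A⟩_{β_p, 0} ≤ ⟨τ_A⟩_{β_p, β_ℓ}` (GKS II in the link coupling).
[cite: MarraMiraclesole1979, §1 p. 235] [cite: FriedliVelenik2017, Exercise 3.31] -/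
theorem pureGauge_le_expect [DecidableEq ι] {βp βl : ℝ} (hp : 0 ≤ βp) (hl : 0 ≤ βl) (A : Finset Λ) :
    gksExpect univ (fun _ : ι => βp) C (spinProduct A) ≤ expect C βp βl (spinProduct A) := by
  rw [← expect_link_zero_eq C βp]
  exact expect_spinProduct_mono C (by rw [abs_of_nonneg hp]) (by simpa using hl) A

end Abstract

end GaugeIsing

/-! ### 2. The torus `(ℤ/Lℤ)^d`: rectangular Wilson loops of the `ℤ₂` gauge–Higgs model -/

section Torus

open GaugeIsing

variable {d L : ℕ} [NeZero L]

/-- The gauge-invariant Ising model (`ℤ₂` gauge theory with `ℤ₂` Higgs matter in unitary gauge) on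
the torus `(ℤ/Lℤ)^d`: link spins, plaquette couplings `β_p` (supports `torusPlaqEdges`) and link
couplings `β_ℓ` (Marra–Miracle-Solé (3) with periodic boundary conditions). [cite: MarraMiraclesole1979, §1 eq. (3)] -/
def gaugeIsingTorusExpect (d L : ℕ) [NeZero L] (βp βl : ℝ) (f : SpinConfig (Edge d L) → ℝ) : ℝ :=
  GaugeIsing.expect (torusPlaqEdges : Plaquette d L → Finset (Edge d L)) βp βl f

/-- **Perimeter-law lower bound for the rectangular Wilson loops of the `ℤ₂` gauge–Higgs model on
the torus** (Marra–Miracle-Solé 1979 p. 235): for `β_p, β_ℓ ≥ 0`,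
`(tanh β_ℓ)^{|∂(R×T)|} ≤ ⟨τ_{∂(R×T)}⟩_{β_p,β_ℓ,L}`, `∂(R×T)` the boundary links (`rectOddEdges`) of the
`R × T` loop at `x` in the `(i,j)` plane; for `β_ℓ > 0` this is a perimeter law
(`|∂(R×T)| ≤ 2(R+T)`). [cite: MarraMiraclesole1979, §1 p. 235] -/
theorem tanh_pow_le_gaugeIsingTorusExpect_wilsonLoop {βp βl : ℝ} (hp : 0 ≤ βp) (hl : 0 ≤ βl)
    (x : Site d L) (i j : Fin d) (R T : ℕ) :
    Real.tanh βl ^ #(rectOddEdges x i j R T) ≤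
      gaugeIsingTorusExpect d L βp βl (spinProduct (rectOddEdges x i j R T)) := by
  classical
  exact tanh_pow_le_expect_spinProduct _ hp hl _

/-- **The pure `ℤ₂` gauge theory Wilson loop is a lower bound of the gauge–Higgs loop**: for
`β_p, β_ℓ ≥ 0` and torus side `L ≥ 2`,
`⟨W_{R×T}⟩_{ℤ₂, β_p, L} ≤ ⟨τ_{∂(R×T)}⟩_{β_p, β_ℓ, L}` (GKS II in `β_ℓ`; the left side is the tree's torus
Wilson theory `wilsonExpectation z2Rep β_p`, identified with the link system by
`gksExpect_const_eq_wilsonExpectation_z2`). [cite: MarraMiraclesole1979, §1 p. 235] -/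
theorem wilsonExpectation_z2_le_gaugeIsingTorusExpect [Fact (1 < L)] {βp βl : ℝ} (hp : 0 ≤ βp)
    (hl : 0 ≤ βl) (x : Site d L) (i j : Fin d) (R T : ℕ) :
    wilsonExpectation (L := L) z2Rep βp (wilsonLoop z2Rep x i j R T) ≤
      gaugeIsingTorusExpect d L βp βl (spinProduct (rectOddEdges x i j R T)) := by
  classical
  have h := pureGauge_le_expect (torusPlaqEdges : Plaquette d L → Finset (Edge d L)) hp hl
    (rectOddEdges x i j R T)
  rw [gksExpect_const_eq_wilsonExpectation_z2] at h
  simp only [← wilsonLoop_z2Rep_eq_spinProduct] at h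
  exact h

end Torus


/-! ### 3. The perimeter: `|∂(R×T)| ≤ 2(R+T)`, so `(tanh β_ℓ)^{2(R+T)} ≤ ⟨τ_{∂(R×T)}⟩` -/

section Perimeter

open scoped symmDiff

variable {d L : ℕ}

/-- A straight lattice path of `n` steps has `n` links. [folklore] -/
private theorem length_lineEdgeList (k : Fin d) :
    ∀ (n : ℕ) (y : Site d L), (lineEdgeList k n y).length = n
  | 0, _ => rfl
  | n + 1, y => by rw [lineEdgeList, List.length_cons, length_lineEdgeList k n]

/-- The boundary of the `R × T` rectangle has `2(R+T)` links (with multiplicity). [folklore] -/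
private theorem length_rectEdgeList (x : Site d L) (i j : Fin d) (R T : ℕ) :
    (rectEdgeList x i j R T).length = 2 * (R + T) := by
  simp only [rectEdgeList, List.length_append, length_lineEdgeList]; ring

/-- The odd support of a list has at most as many elements as the list. [folklore] -/
private theorem card_oddSupport_le [DecidableEq (Edge d L)] :
    ∀ l : List (Edge d L), #(oddSupport l) ≤ l.length
  | [] => by simp [oddSupport]
  | a :: l => by
      rw [oddSupport, List.length_cons]
      calc #({a} ∆ oddSupport l) ≤ #({a} ∪ oddSupport l) :=
            card_le_card (symmDiff_le_sup (a := ({a} : Finset (Edge d L))) (b := oddSupport l))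
        _ ≤ #({a} : Finset (Edge d L)) + #(oddSupport l) := card_union_le _ _
        _ ≤ l.length + 1 := by
            rw [card_singleton]; have := card_oddSupport_le l; omega

/-- **The boundary link set of the `R × T` loop has at most `2(R+T)` links** (its perimeter).
[cite: MarraMiraclesole1979, §1 p. 235] -/
theorem card_rectOddEdges_le [DecidableEq (Edge d L)] (x : Site d L) (i j : Fin d) (R T : ℕ) :
    #(rectOddEdges x i j R T) ≤ 2 * (R + T) := by
  rw [rectOddEdges, ← length_rectEdgeList x i j R T]
  exact card_oddSupport_le _

/-- `0 ≤ tanh k` for `k ≥ 0`. [folklore] -/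
private theorem tanh_nonneg_of_nonneg {k : ℝ} (hk : 0 ≤ k) : 0 ≤ Real.tanh k := by
  rw [Real.tanh_eq_sinh_div_cosh]
  exact div_nonneg (Real.sinh_nonneg_iff.2 hk) (Real.cosh_pos _).le

/-- **Marra–Miracle-Solé perimeter law on the torus, explicit perimeter**: for `β_p, β_ℓ ≥ 0`,
`(tanh β_ℓ)^{2(R+T)} ≤ ⟨τ_{∂(R×T)}⟩_{β_p,β_ℓ,L}` — «the behaviour of `⟨τ_Γ⟩` is always ruled by the
perimeter `|Γ|`» whenever `β_ℓ > 0`. [cite: MarraMiraclesole1979, §1 p. 235] -/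
theorem tanh_pow_perimeter_le_gaugeIsingTorusExpect_wilsonLoop [NeZero L] {βp βl : ℝ} (hp : 0 ≤ βp)
    (hl : 0 ≤ βl) (x : Site d L) (i j : Fin d) (R T : ℕ) :
    Real.tanh βl ^ (2 * (R + T)) ≤
      gaugeIsingTorusExpect d L βp βl (spinProduct (rectOddEdges x i j R T)) := by
  classical
  refine le_trans ?_ (tanh_pow_le_gaugeIsingTorusExpect_wilsonLoop hp hl x i j R T)
  exact pow_le_pow_of_le_one (tanh_nonneg_of_nonneg hl) (Real.tanh_lt_one βl).le
    (card_rectOddEdges_le x i j R T)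

end Perimeter


/-! ### 4. Griffiths' second inequality in `β` for the pure `ℤ₂` torus Wilson loops -/

section Z2Mono

variable {d L : ℕ} [NeZero L] [Fact (1 < L)]

/-- **`ℤ₂` torus Wilson loops are non-decreasing in `β ≥ 0`** (GKS II in the plaquette coupling,
Friedli–Velenik Exercise 3.31 applied to the link system of `ℤ₂` lattice gauge theory; the
companion of `u1_wilsonExpectation_wilsonLoop_mono` / `zn_wilsonExpectation_wilsonLoop_mono` of
`ZnCentreDominatedWilsonLoops.lean`): `⟨W_{R×T}⟩_{ℤ₂,β,L} ≤ ⟨W_{R×T}⟩_{ℤ₂,β',L}` for `0 ≤ β ≤ β'`.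
[cite: FriedliVelenik2017, Exercise 3.31] [cite: MarraMiraclesole1979, §1 p. 235] -/
theorem z2_wilsonExpectation_wilsonLoop_mono {β β' : ℝ} (hβ : 0 ≤ β) (hββ' : β ≤ β') (x : Site d L)
    (i j : Fin d) (R T : ℕ) :
    wilsonExpectation (L := L) z2Rep β (wilsonLoop z2Rep x i j R T) ≤
      wilsonExpectation (L := L) z2Rep β' (wilsonLoop z2Rep x i j R T) := by
  classical
  have h := gksExpect_mono_of_abs_le (univ : Finset (Plaquette d L))
    (torusPlaqEdges : Plaquette d L → Finset (Edge d L)) (K := fun _ => β') (K' := fun _ => β)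
    (fun _ _ => by rw [abs_of_nonneg hβ]; exact hββ') (rectOddEdges x i j R T)
  rw [gksExpect_const_eq_wilsonExpectation_z2, gksExpect_const_eq_wilsonExpectation_z2] at h
  simp only [← wilsonLoop_z2Rep_eq_spinProduct] at h
  exact h

end Z2Mono

end Literature.MathematicalPhysics.QuantumFieldTheory

end
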